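import Summits.FinalStateConjecture.FinalStateConjecture.Theorems.ZeroEnergyKerrOrBombSymplecticDualOfTheBombSig
import Summits.FinalStateConjecture.FinalStateConjecture.Theorems.ZeroEnergyKerrOrBombStationaryLimitReductionStubMoncriefTransversality
import Summits.FinalStateConjecture.FinalStateConjecture.Theorems.ZeroEnergyKerrOrBombStationaryLimitReductionMoncriefFactsAudit
import HarnessLib

/-!
# Route ZeroEnergyKerrOrBomb · crux `StationaryLimitReduction`, line `symplectic-dual-of-the-bomb`
# (reshape r5): stub `stub_moncriefFacts` — fact (b) for `k` detectors REDUCED to single detection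
# (linear algebra on the detection rows), and the reshaped stub

Helper file (`--supports stmt-FinalStateConjecture-10021`; registered helpers
`localMoncriefDuality_of_singleDetection`, `stub_moncriefFacts_of_facts`) of the wave-3 stub-worker
for stub 4 `stub_moncriefFacts : Sig.stub_moncriefFacts` (lead
prover-line-stmt-FinalStateConjecture-10021-a2-0, 2026-08-16); companion of
`…StationaryLimitReductionMoncriefFactsWave3.lean` (fact (a) as the cited named fact
`ChruscielDelay_localConstraintDeformation` and its bridge; `singleDetection_of_localMoncriefDuality`).

Fact (b) `LocalMoncriefDualityAt 𝒟 x₀` (p105738) asks, for `k` symmetric detectors no non-trivial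
combination of which is a local slice tangent at `x₀`, for `k` compactly supported linearised
solutions with invertible `k × k` pairing matrix. Everything here is PROVED:

* §1 the symplectic density `omegaDensity` and — given integrability of each summand — the chart
  pairing `chartPairing` are LINEAR IN THE DETECTOR (`omegaDensity_sum_detectors`,
  `chartPairing_sum_detectors`; the kick slot was done in p105738), and finite real combinations of
  fields smooth on `U` are smooth on `U` (`smoothBilinOn_sum_smul`, Mathlib's `C^n` sections);
* §2 the integrability device `IsIntegrableKickOn` (the pairing integrand of the kick against every
  pair smooth on `U` is integrable on the chart target — true for smooth kicks vanishing off a compact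
  subset of `U`, not recorded by the witness-family interface `IsLinearisedSolutionIn`) and the
  predicate `LocalSingleDetectionAt 𝒟 x₀`: every symmetric non-gauge pair smooth on `U ∋ x₀` is
  detected by an integrable compactly supported linearised solution in `U` — the LINEAR RESIDUE of
  (b), unprinted in this localised form (Moncrief's `L²` splitting is printed for compact slices);
* §3 linear algebra: a set of rows of `ℝᵏ` meeting the complement of every hyperplane `c^⊥`,
  `c ≠ 0`, contains `k` linearly independent rows, i.e. an invertible `k × k` minor
  (`exists_det_ne_zero_of_forall_detects`, induction with `Submodule.exists_le_ker_of_lt_top`);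
* §4 `localMoncriefDuality_of_singleDetection` (registered): `LocalSingleDetectionAt 𝒟 x₀ →
  LocalMoncriefDualityAt 𝒟 x₀` — the detection rows of the integrable kicks in `U` meet every
  `c^⊥`, because the combined detector `Σ c_l (A_l, B_l)` is symmetric, smooth on `U`, non-gauge by
  hypothesis, hence singly detected, and its pairing is `Σ c_l ·` (row) by §1; §3 then gives `k`
  kicks with invertible pairing matrix, supported in the union of their supports;
* §5 `stub_moncriefFacts_of_facts` (registered): `Sig.stub_moncriefFacts` from
  `∀ X D 𝒟 x₀, LocalConstraintDeformationAt 𝒟 x₀` (⇐ the cited fact, companion file) and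
  `∀ X D 𝒟 x₀, LocalSingleDetectionAt 𝒟 x₀` — the recommended reshape of stub 4.

No new axioms, no `sorry`; the only unproved inputs appear as explicit hypotheses.
-/

-- every `Summit.FinalStateConjecture.FinalStateConjecture.…` name repeats the summit = sub-problem segment (D-0017 layout)
set_option linter.dupNamespace false
set_option maxSynthPendingDepth 3

noncomputable section

open scoped Manifold ContDiff Topology BigOperators
open Set Filter Bundle MeasureTheory Literature.Geometry.Lorentzian

namespace Summit.FinalStateConjecture.FinalStateConjecture.Theorems.SymplecticDualOfTheBomb

open Summit.FinalStateConjecture.FinalStateConjecture.Theorems.OneLockedExplosion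

/-! ## §1 Linearity of the symplectic density and of the chart pairing in the DETECTOR slot -/

section DetectorLinearity

variable {X : Type} [TopologicalSpace X] [ChartedSpace E3 X] [IsManifold (𝓡 3) ∞ X]

/-- `⟨S + S', T⟩_h = ⟨S, T⟩_h + ⟨S', T⟩_h`. [folklore] -/
theorem symInner_add_left (D : InitialDataSet (𝓡 3) X) (x : X)
    (S S' T : TangentSpace (𝓡 3) x →L[ℝ] TangentSpace (𝓡 3) x →L[ℝ] ℝ) :
    symInner D x (S + S') T = symInner D x S T + symInner D x S' T := by
  unfold symInner
  rw [← map_add]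
  congr 1
  refine LinearMap.ext fun v ↦ ?_
  have h1 : ∀ u, (S + S').toLinearMap₁₂ u = S.toLinearMap₁₂ u + S'.toLinearMap₁₂ u :=
    fun u ↦ LinearMap.ext fun _ ↦ rfl
  simp only [LinearMap.comp_apply, LinearMap.add_apply, h1, map_add]

/-- `⟨S, T + T'⟩_h = ⟨S, T⟩_h + ⟨S, T'⟩_h`. [folklore] -/
theorem symInner_add_right (D : InitialDataSet (𝓡 3) X) (x : X)
    (S T T' : TangentSpace (𝓡 3) x →L[ℝ] TangentSpace (𝓡 3) x →L[ℝ] ℝ) :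
    symInner D x S (T + T') = symInner D x S T + symInner D x S T' := by
  unfold symInner
  rw [← map_add]
  congr 1
  refine LinearMap.ext fun v ↦ ?_
  have h1 : (T + T').toLinearMap₁₂.flip v = T.toLinearMap₁₂.flip v + T'.toLinearMap₁₂.flip v :=
    LinearMap.ext fun _ ↦ rfl
  simp only [LinearMap.comp_apply, LinearMap.add_apply, h1, map_add]

/-- `tr_h (S + S') = tr_h S + tr_h S'`. [folklore] -/
theorem hTrace_add (D : InitialDataSet (𝓡 3) X) (x : X)
    (S S' : TangentSpace (𝓡 3) x →L[ℝ] TangentSpace (𝓡 3) x →L[ℝ] ℝ) :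
    hTrace D x (S + S') = hTrace D x S + hTrace D x S' := by
  unfold hTrace PseudoRiemannianMetric.trace
  rw [← map_add]
  congr 1
  refine LinearMap.ext fun v ↦ ?_
  have h1 : (S + S').toLinearMap₁₂ v = S.toLinearMap₁₂ v + S'.toLinearMap₁₂ v := LinearMap.ext fun _ ↦ rfl
  simp only [LinearMap.comp_apply, LinearMap.add_apply, h1, map_add]

/-- `⟨∑ⱼ cⱼ Sⱼ, T⟩_h = ∑ⱼ cⱼ ⟨Sⱼ, T⟩_h`. [folklore] -/
theorem symInner_sum_smul_left (D : InitialDataSet (𝓡 3) X) (x : X) {k : ℕ} (c : Fin k → ℝ)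
    (S : Fin k → (TangentSpace (𝓡 3) x →L[ℝ] TangentSpace (𝓡 3) x →L[ℝ] ℝ))
    (T : TangentSpace (𝓡 3) x →L[ℝ] TangentSpace (𝓡 3) x →L[ℝ] ℝ) (s : Finset (Fin k)) :
    symInner D x (∑ j ∈ s, c j • S j) T = ∑ j ∈ s, c j * symInner D x (S j) T := by
  classical
  induction s using Finset.induction_on with
  | empty => simpa using symInner_smul_left D x 0 0 T
  | insert j s hj ih =>
    rw [Finset.sum_insert hj, Finset.sum_insert hj, symInner_add_left, symInner_smul_left, ih]

/-- `⟨S, ∑ⱼ cⱼ Tⱼ⟩_h = ∑ⱼ cⱼ ⟨S, Tⱼ⟩_h`. [folklore] -/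
theorem symInner_sum_smul_right (D : InitialDataSet (𝓡 3) X) (x : X) {k : ℕ} (c : Fin k → ℝ)
    (S : TangentSpace (𝓡 3) x →L[ℝ] TangentSpace (𝓡 3) x →L[ℝ] ℝ)
    (T : Fin k → (TangentSpace (𝓡 3) x →L[ℝ] TangentSpace (𝓡 3) x →L[ℝ] ℝ)) (s : Finset (Fin k)) :
    symInner D x S (∑ j ∈ s, c j • T j) = ∑ j ∈ s, c j * symInner D x S (T j) := by
  classical
  induction s using Finset.induction_on with
  | empty => simpa using symInner_smul_right D x 0 S 0
  | insert j s hj ih =>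
    rw [Finset.sum_insert hj, Finset.sum_insert hj, symInner_add_right, symInner_smul_right, ih]

/-- `tr_h (∑ⱼ cⱼ Sⱼ) = ∑ⱼ cⱼ tr_h Sⱼ`. [folklore] -/
theorem hTrace_sum_smul (D : InitialDataSet (𝓡 3) X) (x : X) {k : ℕ} (c : Fin k → ℝ)
    (S : Fin k → (TangentSpace (𝓡 3) x →L[ℝ] TangentSpace (𝓡 3) x →L[ℝ] ℝ)) (s : Finset (Fin k)) :
    hTrace D x (∑ j ∈ s, c j • S j) = ∑ j ∈ s, c j * hTrace D x (S j) := by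
  classical
  induction s using Finset.induction_on with
  | empty => simpa using hTrace_smul D x 0 0
  | insert j s hj ih =>
    rw [Finset.sum_insert hj, Finset.sum_insert hj, hTrace_add, hTrace_smul, ih]

/-- **The symplectic density is linear in the detector**:
`ω((∑ cⱼ Aⱼ, ∑ cⱼ Bⱼ), (a, b)) = ∑ cⱼ ω((Aⱼ, Bⱼ), (a, b))` pointwise (each of its six terms is
bilinear). [folklore] -/
theorem omegaDensity_sum_detectors (D : InitialDataSet (𝓡 3) X) {k : ℕ} (c : Fin k → ℝ)
    (A B : Fin k → BilinField X) (a b : BilinField X) (x : X) :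
    omegaDensity D (fun x ↦ ∑ j, c j • A j x) (fun x ↦ ∑ j, c j • B j x) a b x =
      ∑ j, c j * omegaDensity D (A j) (B j) a b x := by
  simp only [omegaDensity, symInner_sum_smul_left, symInner_sum_smul_right, hTrace_sum_smul,
    Finset.sum_mul, Finset.mul_sum, Finset.sum_div, ← Finset.sum_sub_distrib,
    ← Finset.sum_add_distrib]
  refine Finset.sum_congr rfl fun j _ ↦ ?_
  ring

/-- **The chart pairing is linear in the detector, GIVEN integrability** of every summand's
integrand on the chart target (`∫ ∑ cⱼ fⱼ = ∑ cⱼ ∫ fⱼ` needs each `fⱼ` integrable; homogeneity,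
`chartPairing_smul`, does not). [folklore] -/
theorem chartPairing_sum_detectors (D : InitialDataSet (𝓡 3) X) (x₀ : X) {k : ℕ} (c : Fin k → ℝ)
    (A B : Fin k → BilinField X) (a b : BilinField X)
    (hint : ∀ j, IntegrableOn (fun y ↦ omegaDensity D (A j) (B j) a b ((extChartAt (𝓡 3) x₀).symm y) *
      Real.sqrt (chartGramMatrix D.h x₀ y).det) (extChartAt (𝓡 3) x₀).target) :
    chartPairing D x₀ (fun x ↦ ∑ j, c j • A j x) (fun x ↦ ∑ j, c j • B j x) a b =
      ∑ j, c j * chartPairing D x₀ (A j) (B j) a b := by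
  unfold chartPairing
  simp_rw [omegaDensity_sum_detectors, Finset.sum_mul, mul_assoc]
  rw [integral_finsetSum _ fun j _ ↦ (hint j).const_mul (c j)]
  simp_rw [integral_const_mul]

/-- A finite real combination of fields of bilinear forms smooth on `U` is smooth on `U` (`C^n`
sections of a vector bundle form a module: Mathlib's `ContMDiffOn.sum_section`,
`ContMDiffOn.const_smul_section`). [folklore] -/
theorem smoothBilinOn_sum_smul {k : ℕ} (c : Fin k → ℝ) (A : Fin k → BilinField X) (U : Set X)
    (hA : ∀ j, SmoothBilinOn (A j) U) : SmoothBilinOn (fun x ↦ ∑ j, c j • A j x) U := by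
  have h := ContMDiffOn.sum_section (s := Finset.univ)
    (fun j _ ↦ (hA j).const_smul_section (a := c j))
  exact h

end DetectorLinearity

/-! ## §2 Integrable kicks; local single detection (the linear residue of fact (b)) -/

section Duality

variable {X : Type} [TopologicalSpace X] [ChartedSpace E3 X] [IsManifold (𝓡 3) ∞ X]

/-- **Integrable kick on `U` (read at the chart of `x₀`)**: the pair `(a, b)` has, against EVERY pair
of fields `(A, B)` smooth on `U`, a symplectic density whose chart expression times `√(det h_{ij})`
is integrable on the chart target at `x₀` — so that its chart pairings with such detectors are
additive in the detector. Automatic for smooth `(a, b)` vanishing off a compact subset of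
`U ⊆` chart source (continuous compactly supported integrand); carried as a clause because
`IsLinearisedSolutionIn` records its tangents only as fibrewise derivatives. [folklore] -/
def IsIntegrableKickOn (D : InitialDataSet (𝓡 3) X) (x₀ : X) (U : Set X) (a b : BilinField X) : Prop :=
  ∀ A B : BilinField X, SmoothBilinOn A U → SmoothBilinOn B U →
    IntegrableOn (fun y ↦ omegaDensity D A B a b ((extChartAt (𝓡 3) x₀).symm y) *
      Real.sqrt (chartGramMatrix D.h x₀ y).det) (extChartAt (𝓡 3) x₀).target

/-- `IsLinearisedSolutionIn` is monotone in the support set (the same witness family). [folklore] -/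
theorem isLinearisedSolutionIn_mono (D : InitialDataSet (𝓡 3) X) (a b : BilinField X) {K K' : Set X}
    (hKK' : K ⊆ K') (h : IsLinearisedSolutionIn D a b K) : IsLinearisedSolutionIn D a b K' := by
  obtain ⟨F, hF, hF0, hsupp, ha, hb, hder⟩ := h
  exact ⟨F, hF, hF0, fun c x hx ↦ hsupp c x fun hxK ↦ hx (hKK' hxK), ha, hb, hder⟩

variable [T2Space X] [SecondCountableTopology X] [ConnectedSpace X] {D : InitialDataSet (𝓡 3) X}

/-- **Local single detection at `x₀`** — the `k = 1`, integrable-kick form of local Moncrief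
duality (`LocalMoncriefDualityAt`, p105738), i.e. the contrapositive of the LOCAL ANNIHILATOR LEMMA:
for every symmetric pair `(A, B)` of fields which is not a local slice tangent at `x₀` in the vacuum
development `𝒟` (`IsLocalSliceTangentAt`) and every open `U ∋ x₀` inside the chart source at `x₀`
on which `A`, `B` are smooth, some solution `(a, b)` of the linearised vacuum constraints supported
in a compact `K ⊆ U` (`IsLinearisedSolutionIn`), with integrable pairing integrands on `U`
(`IsIntegrableKickOn`), has `ω_{x₀}((A, B), (a, b)) ≠ 0` (`chartPairing`). Equivalently: a
symmetric smooth pair `ω`-orthogonal to all such kicks near `x₀` is locally pure gauge,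
`J∘DΦ*(N, Y)` with `(N, Y)` smooth — Moncrief's splitting `ker DΦ ∩ ker(DΦ∘J) ⊕ ran J∘DΦ* ⊕ ran DΦ*`
LOCALISED to a ball (closed range of `DΦ` on perturbations flat at `∂B`, Chruściel–Delay 2004
Prop. 6.5, plus interior elliptic regularity of the overdetermined KID operator and the realisation
of `(N, Y)` as a slice deformation). Printed only globally (Moncrief, J. Math. Phys. 16 (1975) 1556;
Fischer–Marsden–Moncrief, Ann. IHP A 33 (1980) §1–2); NOT proved here: it is the residual input of
stub 4, consumed as an explicit hypothesis below. [cite: Wald1984GR, Appendix E.2] -/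
def LocalSingleDetectionAt (𝒟 : VacuumCauchyDevelopment D) (x₀ : X) : Prop :=
  ∀ (A B : BilinField X),
    (∀ x (v w : TangentSpace (𝓡 3) x), A x v w = A x w v ∧ B x v w = B x w v) →
    ¬ IsLocalSliceTangentAt 𝒟 A B x₀ →
    ∀ U : Set X, IsOpen U → x₀ ∈ U → U ⊆ (extChartAt (𝓡 3) x₀).source →
      SmoothBilinOn A U → SmoothBilinOn B U →
      ∃ (a b : BilinField X) (K : Set X), IsCompact K ∧ K ⊆ U ∧
        IsLinearisedSolutionIn D a b K ∧ IsIntegrableKickOn D x₀ U a b ∧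
        chartPairing D x₀ A B a b ≠ 0

end Duality

/-! ## §3 Linear algebra: rows meeting the complement of every hyperplane contain an invertible minor -/

/-- If a set `S ⊆ ℝᵏ` of rows detects every non-zero coefficient vector (`∀ c ≠ 0, ∃ r ∈ S, c · r ≠ 0`,
i.e. `S` spans `ℝᵏ`), then for every `m ≤ k` it contains `m` linearly independent rows: a span of
`m < k` rows is a proper subspace, annihilated by a non-zero functional `c ·`
(`Submodule.exists_le_ker_of_lt_top`), and a row of `S` detecting `c` lies outside that span
(`linearIndependent_finCons`). [folklore] -/
theorem exists_linearIndependent_of_forall_detects {k : ℕ} (S : Set (Fin k → ℝ))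
    (h : ∀ c : Fin k → ℝ, c ≠ 0 → ∃ r ∈ S, ∑ l, c l * r l ≠ 0) :
    ∀ m ≤ k, ∃ r : Fin m → (Fin k → ℝ), (∀ j, r j ∈ S) ∧ LinearIndependent ℝ r := by
  intro m
  induction m with
  | zero => exact fun _ ↦ ⟨fun j ↦ j.elim0, fun j ↦ j.elim0, linearIndependent_empty_type⟩
  | succ m ih =>
    intro hm
    obtain ⟨r, hrS, hli⟩ := ih (Nat.le_of_succ_le hm)
    have hlt : Submodule.span ℝ (Set.range r) < ⊤ := by
      apply Submodule.lt_top_of_finrank_lt_finrank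
      calc Module.finrank ℝ (Submodule.span ℝ (Set.range r)) ≤ Fintype.card (Fin m) :=
            finrank_range_le_card r
        _ = m := Fintype.card_fin m
        _ < k := hm
        _ = Module.finrank ℝ (Fin k → ℝ) := (Module.finrank_fin_fun ℝ).symm
    obtain ⟨f, hf0, hker⟩ := Submodule.exists_le_ker_of_lt_top _ hlt
    set c : Fin k → ℝ := fun l ↦ f (fun j ↦ if l = j then 1 else 0) with hc
    have hfc : ∀ x : Fin k → ℝ, f x = ∑ l, c l * x l := fun x ↦ by
      rw [LinearMap.pi_apply_eq_sum_univ f x]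
      simp only [hc, smul_eq_mul, mul_comm]
    have hc0 : c ≠ 0 := by
      intro h0
      apply hf0
      refine LinearMap.ext fun x ↦ ?_
      rw [hfc x]
      simp [h0]
    obtain ⟨r', hr'S, hr'⟩ := h c hc0
    have hnot : r' ∉ Submodule.span ℝ (Set.range r) := fun hmem ↦
      hr' (by rw [← hfc]; exact hker hmem)
    refine ⟨Fin.cons r' r, fun j ↦ Fin.cases (by simpa using hr'S) (fun i ↦ by simpa using hrS i) j,
      linearIndependent_finCons.2 ⟨hli, hnot⟩⟩

/-- **Rows detecting every non-zero combination contain an invertible `k × k` minor**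
(`k` linearly independent rows of a square matrix make it a unit). [folklore] -/
theorem exists_det_ne_zero_of_forall_detects {k : ℕ} (S : Set (Fin k → ℝ))
    (h : ∀ c : Fin k → ℝ, c ≠ 0 → ∃ r ∈ S, ∑ l, c l * r l ≠ 0) :
    ∃ r : Fin k → Fin k → ℝ, (∀ j, r j ∈ S) ∧ (Matrix.of fun j l ↦ r j l).det ≠ 0 := by
  obtain ⟨r, hrS, hli⟩ := exists_linearIndependent_of_forall_detects S h k le_rfl
  refine ⟨r, hrS, ?_⟩
  have hunit : IsUnit (Matrix.of fun j l ↦ r j l) :=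
    Matrix.linearIndependent_rows_iff_isUnit.1 hli
  exact ((Matrix.isUnit_iff_isUnit_det _).1 hunit).ne_zero

/-! ## §4 The reduction: local Moncrief duality for `k` detectors from local single detection -/

/-- **Local Moncrief duality from local single detection** (registered helper). Given `k` symmetric
detectors `(A_l, B_l)` smooth on an open `U ∋ x₀` inside the chart source, no non-trivial
combination of which is a local slice tangent at `x₀`, let `S ⊆ ℝᵏ` be the set of detection rows
`(ω_{x₀}((A_l, B_l), (a, b)))_l` of the linearised solutions `(a, b)` supported in compact subsets of
`U` with integrable kicks on `U`. For `c ≠ 0` the combined detector `Σ c_l (A_l, B_l)` is symmetric,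
smooth on `U` (`smoothBilinOn_sum_smul`) and non-gauge at `x₀` by hypothesis, so single detection
yields such a kick pairing non-trivially with it; by detector-linearity of the chart pairing
(`chartPairing_sum_detectors`, integrability from `IsIntegrableKickOn`) that pairing is `c ·` its
row: `S` meets the complement of every hyperplane. Hence (`exists_det_ne_zero_of_forall_detects`)
`k` kicks with invertible pairing matrix, all supported in the compact union of their supports
(`isLinearisedSolutionIn_mono`). [cite: Wald1984GR, Appendix E.2] -/
theorem localMoncriefDuality_of_singleDetection : ∀ (X : Type) [TopologicalSpace X] [ChartedSpace E3 X] [IsManifold (𝓡 3) ∞ X] [T2Space X] [SecondCountableTopology X] [ConnectedSpace X] (D : InitialDataSet (𝓡 3) X) (𝒟 : VacuumCauchyDevelopment D) (x₀ : X), LocalSingleDetectionAt 𝒟 x₀ → LocalMoncriefDualityAt 𝒟 x₀ := by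
  intro X _ _ _ _ _ _ D 𝒟 x₀ hSD k A B hsymm hng U hU hxU hUsrc hsm
  -- the detection rows of the integrable kicks in `U`
  set S : Set (Fin k → ℝ) := {r | ∃ (a b : BilinField X) (K : Set X), IsCompact K ∧ K ⊆ U ∧
      IsLinearisedSolutionIn D a b K ∧ IsIntegrableKickOn D x₀ U a b ∧
      r = fun l ↦ chartPairing D x₀ (A l) (B l) a b} with hSdef
  have hS : ∀ c : Fin k → ℝ, c ≠ 0 → ∃ r ∈ S, ∑ l, c l * r l ≠ 0 := by
    intro c hc
    have hsymmC : ∀ x (v w : TangentSpace (𝓡 3) x),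
        (∑ j, c j • A j x) v w = (∑ j, c j • A j x) w v ∧
          (∑ j, c j • B j x) v w = (∑ j, c j • B j x) w v := fun x v w ↦ by
      simp only [FunLike.coe_sum, FunLike.coe_smul, Finset.sum_apply, Pi.smul_apply]
      exact ⟨Finset.sum_congr rfl fun j _ ↦ by rw [(hsymm j x v w).1],
        Finset.sum_congr rfl fun j _ ↦ by rw [(hsymm j x v w).2]⟩
    have hsmA : SmoothBilinOn (fun x ↦ ∑ j, c j • A j x) U :=
      smoothBilinOn_sum_smul c A U fun j ↦ (hsm j).1
    have hsmB : SmoothBilinOn (fun x ↦ ∑ j, c j • B j x) U :=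
      smoothBilinOn_sum_smul c B U fun j ↦ (hsm j).2
    obtain ⟨a, b, K, hKc, hKU, hlin, hint, hpair⟩ :=
      hSD _ _ hsymmC (hng c hc) U hU hxU hUsrc hsmA hsmB
    refine ⟨fun l ↦ chartPairing D x₀ (A l) (B l) a b, ⟨a, b, K, hKc, hKU, hlin, hint, rfl⟩, ?_⟩
    rwa [← chartPairing_sum_detectors D x₀ c A B a b fun j ↦ hint (A j) (B j) (hsm j).1 (hsm j).2]
  obtain ⟨r, hrS, hdet⟩ := exists_det_ne_zero_of_forall_detects S hS
  have hrS' : ∀ j, ∃ (a b : BilinField X) (K : Set X), IsCompact K ∧ K ⊆ U ∧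
      IsLinearisedSolutionIn D a b K ∧ IsIntegrableKickOn D x₀ U a b ∧
      r j = fun l ↦ chartPairing D x₀ (A l) (B l) a b := hrS
  choose a b K hKc hKU hlin _hint hr using hrS'
  refine ⟨a, b, ⋃ j, K j, isCompact_iUnion hKc, Set.iUnion_subset hKU,
    fun j ↦ isLinearisedSolutionIn_mono D (a j) (b j) (Set.subset_iUnion K j) (hlin j), ?_⟩
  have hM : (Matrix.of fun j l ↦ chartPairing D x₀ (A l) (B l) (a j) (b j)) =
      Matrix.of fun j l ↦ r j l := by
    ext j l
    simp only [Matrix.of_apply, hr j]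
  rwa [hM]

/-! ## §5 The reshaped stub: `Sig.stub_moncriefFacts` from fact (a) and single detection -/

/-- **Stub 4 from its two inputs after this wave** (registered helper): the conjunction
`Sig.stub_moncriefFacts` follows from `∀ X D 𝒟 x₀, LocalConstraintDeformationAt 𝒟 x₀` — supplied by
the cited Literature fact `ChruscielDelay_localConstraintDeformation` through
`localConstraintDeformationAt_of_fact` (companion file) — and the unprinted linear residue
`∀ X D 𝒟 x₀, LocalSingleDetectionAt 𝒟 x₀` (via `localMoncriefDuality_of_singleDetection`). [folklore] -/
theorem stub_moncriefFacts_of_facts : (∀ (X : Type) [TopologicalSpace X] [ChartedSpace E3 X] [IsManifold (𝓡 3) ∞ X] [T2Space X] [SecondCountableTopology X] [ConnectedSpace X] (D : InitialDataSet (𝓡 3) X) (𝒟 : VacuumCauchyDevelopment D) (x₀ : X), LocalConstraintDeformationAt 𝒟 x₀) → (∀ (X : Type) [TopologicalSpace X] [ChartedSpace E3 X] [IsManifold (𝓡 3) ∞ X] [T2Space X] [SecondCountableTopology X] [ConnectedSpace X] (D : InitialDataSet (𝓡 3) X) (𝒟 : VacuumCauchyDevelopment D) (x₀ : X), LocalSingleDetectionAt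 𝒟 x₀) → Sig.stub_moncriefFacts :=
  fun hA hB ↦ ⟨hA, fun X _ _ _ _ _ _ D 𝒟 x₀ ↦ localMoncriefDuality_of_singleDetection X D 𝒟 x₀ (hB X D 𝒟 x₀)⟩

end Summit.FinalStateConjecture.FinalStateConjecture.Theorems.SymplecticDualOfTheBomb

end
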